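import Summits.KontsevichZagierPeriods.KontsevichZagierPeriods.Theorems.SymplecticScissorsRealOnePeriodRelationsStubArcSymbolsAux
import Summits.KontsevichZagierPeriods.KontsevichZagierPeriods.Theorems.SymplecticScissorsCurvePeriodsTransferStubEtaleShift
import Summits.KontsevichZagierPeriods.KontsevichZagierPeriods.Theorems.SymplecticScissorsCurvePeriodsTransferStubSectionSymbol
import Literature.NumberTheory.Transcendental.SemialgebraicLineDeriv
import Literature.NumberTheory.Transcendental.KZSemialgebraicComplex

/-!
# `RealOnePeriodRelations` (stmt-KontsevichZagierPeriods-10042), line `nash-retraction-thin-strip`: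
# stub `stub_arcSymbols`, auxiliary file 2 — standard pieces are period symbols

A STANDARD PIECE is a function `g` on `[0,1]` which is real-analytic at every point of `[0,1]`,
has algebraic Taylor coefficients at `0` and an algebraic value at `1`, is `ℚ`-semialgebraic on
`[0,1]`, and is an étale branch on `(0,1]` of a plane curve `G(s, y) = 0` with algebraic
coefficients (`G(s, g s) = 0` on `[0,1]`, `∂_y G(s, g s) ≠ 0` on `(0,1]`); this is the output of the
piece reduction of a 1-dimensional Kontsevich–Zagier representation (cutting at bad points, affine
normalisation, Puiseux flattening of the bad end). Here we show that `∫₀¹ g` is the period of a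
symbol of curve type along a `ℚ`-semialgebraic path, realised with coefficient `1` by every
representation `[∫_{(0,1)} g]` (`piece_symbol`): the étale Taylor shift `g = T + sᴷ u` at `s = 0`
(`CurvePeriodsTransfer.stub_etaleShift`, sibling crux stmt-11129) makes the end point étale for the
shifted curve `G_K`, the global section `ũ = (g − T)/sᴷ` on `(0,1]`, `ũ = u` near `0`, is analytic
and semialgebraic on `[0,1]`, and the section symbol on the standard-étale model of `G_K`
(`CurvePeriodsTransfer.stub_sectionSymbol`) does the rest. Combined with the assembly of auxiliary
file 1 this gives `arcSymbols_of_pieces`: the conclusion of `stub_arcSymbols` for every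
representation that admits a piece reduction.

References: A. Huber, G. Wüstholz, *Transcendence and Linear Relations of 1-Periods* (2022),
Prop. 12.5, §3.3.1; J. Bochnak, M. Coste, M.-F. Roy, *Real Algebraic Geometry* (1998), §8.1.
-/

noncomputable section

open scoped BigOperators Topology
open Set MeasureTheory Filter MvPolynomial
open Literature.NumberTheory.Transcendental Literature.NumberTheory.Transcendental.CurvePeriods
open Literature.ModelTheory.ExponentialFields (IsSemialgebraic)
open Summit.KontsevichZagierPeriods.SymplecticScissors.RealOnePeriodRelationsNegative (M₁)
open Summit.KontsevichZagierPeriods.SymplecticScissors.CurvePeriodsTransfer (stub_sectionSymbol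
  stub_etaleShift)

namespace Summit.KontsevichZagierPeriods.SymplecticScissors.RealOnePeriodRelations

namespace ArcSymbols

/-- A real polynomial with algebraic coefficients takes algebraic values at algebraic points.
[folklore] -/
theorem isAlgebraic_polynomial_eval {T : Polynomial ℝ} (hT : ∀ i, IsAlgebraic ℚ (T.coeff i))
    {x : ℝ} (hx : IsAlgebraic ℚ x) : IsAlgebraic ℚ (T.eval x) := by
  rw [Polynomial.eval_eq_sum, Polynomial.sum_def]
  exact Finset.sum_induction _ (IsAlgebraic ℚ) (fun _ _ ha hb => ha.add hb) isAlgebraic_zero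
    fun i _ => (hT i).mul (hx.pow _)

/-- A real polynomial with algebraic coefficients is a `ℚ`-semialgebraic function of one
variable on every `ℚ`-semialgebraic set. [folklore] -/
theorem isSemialgebraicFunOn_polynomial_eval {W : Set (Fin 1 → ℝ)} (hW : IsSemialgebraic ℚ W)
    {T : Polynomial ℝ} (hT : ∀ i, IsAlgebraic ℚ (T.coeff i)) :
    IsSemialgebraicFunOn ℚ W (fun z => T.eval (z 0)) := by
  have h : IsSemialgebraicFunOn ℚ W (fun z => ∑ i ∈ T.support, T.coeff i * (z 0) ^ i) :=
    IsSemialgebraicFunOn.fun_finsetSum _ hW fun i _ =>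
      (isSemialgebraicFunOn_const_of_isAlgebraic hW (hT i)).fun_mul
        (((isSemialgebraicFunOn_aeval hW (X 0)).congr fun z _ => by simp).fun_pow i)
  refine h.congr fun z _ => ?_
  rw [Polynomial.eval_eq_sum, Polynomial.sum_def]

/-- THE GLOBAL SECTION OF A STANDARD PIECE. A standard piece `g` on `[0,1]`
(analytic on `[0,1]`, algebraic Taylor coefficients at `0`, algebraic value at `1`,
`ℚ`-semialgebraic, an étale branch of `G = 0` on `(0,1]`) is the period of a symbol of curve type
along a `ℚ`-semialgebraic path, realised with coefficient `1` by every representation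
`[∫_{(0,1)} g]`: shift `g = T + sᴷu` at `0` (the étale Taylor shift
`CurvePeriodsTransfer.stub_etaleShift` of the sibling crux), take the global section
`ũ = (g − T)/sᴷ` on `(0,1]`, `ũ = u` near `0`, and the section symbol of `(G_K, T, K, ũ)`
(`CurvePeriodsTransfer.stub_sectionSymbol`). [cite: HuberWustholz2022, §3.3.1] -/
theorem piece_symbol
    (g : ℝ → ℝ) (G : MvPolynomial (Fin 2) ℝ) (hG : ∀ d, IsAlgebraic ℚ (G.coeff d))
    (hg_an : ∀ s ∈ Set.Icc (0 : ℝ) 1, AnalyticAt ℝ g s)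
    (hTay : ∀ n, IsAlgebraic ℚ (iteratedDeriv n g 0)) (hg1 : IsAlgebraic ℚ (g 1))
    (hsa : IsSemialgebraicFunOn ℚ {z : Fin 1 → ℝ | z 0 ∈ Set.Icc (0 : ℝ) 1} (fun z => g (z 0)))
    (hroot : ∀ s ∈ Set.Icc (0 : ℝ) 1, MvPolynomial.eval ![s, g s] G = 0)
    (het : ∀ s ∈ Set.Ioc (0 : ℝ) 1, MvPolynomial.eval ![s, g s] (MvPolynomial.pderiv 1 G) ≠ 0) :
    ∃ S : PeriodSymbol,
      IsSemialgebraicMapOn ℚ {z : Fin 1 → ℝ | z 0 ∈ Set.Icc (0 : ℝ) 1}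
        (fun z => Fin.append (fun i => (S.γ.toFun (z 0) i).re) (fun i => (S.γ.toFun (z 0) i).im)) ∧
      S.period = ((∫ s in (0 : ℝ)..1, g s : ℝ) : ℂ) ∧
      ∀ r : KZ.IntegralRep 1, r.domain = {z | z 0 ∈ Set.Ioo (0 : ℝ) 1} →
        (∀ z ∈ r.domain, r.integrand z = g (z 0)) →
        (r.domain = {z | z 0 ∈ Set.Ioo (0 : ℝ) 1} ∧ ∀ z ∈ r.domain, r.integrand z =
          ((1 : ℂ) * ∑ i, MvPolynomial.eval (S.γ.toFun (z 0)) (S.ω i) *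
            deriv (fun t => S.γ.toFun t i) (z 0)).re) := by
  -- the shift at `0`
  have h0 : (0 : ℝ) ∈ Set.Icc (0 : ℝ) 1 := ⟨le_rfl, zero_le_one⟩
  have hIoo : Set.Ioo (0 : ℝ) 1 ∈ 𝓝[>] (0 : ℝ) := Ioo_mem_nhdsGT zero_lt_one
  obtain ⟨K, e, T, GK, u, hT, hGK, hid1, hid2, hu_an, hgT, hu0, hGK0, hGK1⟩ :=
    stub_etaleShift g G (hg_an 0 h0) hTay hG
      (mem_of_superset hIoo fun s hs => hroot s (Ioo_subset_Icc_self hs))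
      (mem_of_superset hIoo fun s hs => het s ⟨hs.1, hs.2.le⟩)
  -- the global section
  set v : ℝ → ℝ := fun s => (g s - T.eval s) / s ^ K with hv
  set ut : ℝ → ℝ := fun s => if s ≤ 0 then u s else v s with hut
  have hut0 : ut 0 = u 0 := by simp [hut]
  have hut_pos : ∀ s, 0 < s → ut s = v s := fun s hs => by simp [hut, not_le.mpr hs]
  have hgv : ∀ s, 0 < s → T.eval s + s ^ K * ut s = g s := fun s hs => by
    rw [hut_pos s hs, hv]
    have : s ^ K ≠ 0 := pow_ne_zero _ hs.ne'
    field_simp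
    ring
  have hut_ev : ut =ᶠ[𝓝 0] u := by
    filter_upwards [hgT] with s hs
    by_cases h : s ≤ 0
    · simp [hut, h]
    · have hs0 : 0 < s := lt_of_not_ge h
      rw [hut_pos s hs0]
      show (g s - T.eval s) / s ^ K = u s
      rw [hs]
      have : s ^ K ≠ 0 := pow_ne_zero _ hs0.ne'
      field_simp
      ring
  have hg0 : T.eval 0 + (0 : ℝ) ^ K * ut 0 = g 0 := by
    rw [hut0, hgT.self_of_nhds]
  have hgIcc : ∀ s ∈ Set.Icc (0 : ℝ) 1, T.eval s + s ^ K * ut s = g s := fun s hs => by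
    rcases hs.1.eq_or_lt with h | h
    · rw [← h]; exact hg0
    · exact hgv s h
  -- analyticity
  have hT_an : ∀ s : ℝ, AnalyticAt ℝ (fun x => T.eval x) s := fun s =>
    (AnalyticOnNhd.eval_polynomial (𝕜 := ℝ) T) s (Set.mem_univ _)
  have hut_an : ∀ s ∈ Set.Icc (0 : ℝ) 1, AnalyticAt ℝ ut s := by
    intro s hs
    rcases hs.1.eq_or_lt with h | h
    · rw [← h]
      exact hu_an.congr hut_ev.symm
    · have hv_an : AnalyticAt ℝ v s := by
        rw [hv]
        exact ((hg_an s hs).sub (hT_an s)).div (analyticAt_id.pow K) (pow_ne_zero _ h.ne')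
      refine hv_an.congr ?_
      filter_upwards [Ioi_mem_nhds h] with x hx
      exact (hut_pos x hx).symm
  -- the étale branch of `GK`
  have hGKroot : ∀ s ∈ Set.Icc (0 : ℝ) 1, MvPolynomial.eval ![s, ut s] GK = 0 := by
    intro s hs
    rcases hs.1.eq_or_lt with h | h
    · rw [← h, hut0]; exact hGK0
    · have h1 := hid1 s (ut s)
      rw [hgv s h, hroot s hs] at h1
      exact (mul_eq_zero.1 h1.symm).resolve_left (pow_ne_zero _ h.ne')
  have hGKet : ∀ s ∈ Set.Icc (0 : ℝ) 1, MvPolynomial.eval ![s, ut s] (MvPolynomial.pderiv 1 GK) ≠ 0 := by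
    intro s hs
    rcases hs.1.eq_or_lt with h | h
    · rw [← h, hut0]; exact hGK1
    · have h2 := hid2 s (ut s)
      rw [hgv s h] at h2
      intro h0
      rw [h0, mul_zero] at h2
      exact (mul_ne_zero (pow_ne_zero _ h.ne') (het s ⟨h, hs.2⟩)) h2
  -- semialgebraicity of the global section on `[0,1]`
  have hIcc_sa : IsSemialgebraic ℚ {z : Fin 1 → ℝ | z 0 ∈ Set.Icc (0 : ℝ) 1} :=
    IsSemialgebraicFunOn.isSemialgebraic_holds hsa
  have hzero_sa : IsSemialgebraic ℚ {z : Fin 1 → ℝ | z 0 = 0} := by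
    simpa using isSemialgebraic_setOf_apply_eq_of_isAlgebraic (n := 1) isAlgebraic_zero 0
  have hIoc_sa : IsSemialgebraic ℚ {z : Fin 1 → ℝ | z 0 ∈ Set.Ioc (0 : ℝ) 1} := by
    have h1 := Literature.ModelTheory.ExponentialFields.isSemialgebraic_setOf_eval_pos (k := ℚ)
      (R := ℝ) (MvPolynomial.X (0 : Fin 1) : MvPolynomial (Fin 1) ℚ)
    have h2 := Literature.ModelTheory.ExponentialFields.isSemialgebraic_setOf_eval_nonneg (k := ℚ)
      (R := ℝ) (1 - MvPolynomial.X (0 : Fin 1) : MvPolynomial (Fin 1) ℚ)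
    convert h1.inter h2 using 1
    ext z
    simp [sub_nonneg]
  have hut_sa : IsSemialgebraicFunOn ℚ {z : Fin 1 → ℝ | z 0 ∈ Set.Icc (0 : ℝ) 1} (fun z => ut (z 0)) := by
    have hA : IsSemialgebraicFunOn ℚ {z : Fin 1 → ℝ | z 0 = 0} (fun _ => u 0) :=
      isSemialgebraicFunOn_const_of_isAlgebraic hzero_sa hu0
    have hB : IsSemialgebraicFunOn ℚ {z : Fin 1 → ℝ | z 0 ∈ Set.Ioc (0 : ℝ) 1} (fun z => v (z 0)) := by
      have hg' : IsSemialgebraicFunOn ℚ {z : Fin 1 → ℝ | z 0 ∈ Set.Ioc (0 : ℝ) 1} (fun z => g (z 0)) :=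
        hsa.mono (fun z hz => Ioc_subset_Icc_self hz) hIoc_sa
      have hX : IsSemialgebraicFunOn ℚ {z : Fin 1 → ℝ | z 0 ∈ Set.Ioc (0 : ℝ) 1} (fun z => z 0) :=
        (isSemialgebraicFunOn_aeval hIoc_sa (X 0)).congr fun z _ => by simp
      have h := (hg'.fun_sub (isSemialgebraicFunOn_polynomial_eval hIoc_sa hT)).fun_mul
        ((hX.fun_pow K).fun_inv)
      refine h.congr fun z _ => ?_
      simp [hv, div_eq_mul_inv]
    have hU := IsSemialgebraicFunOn.union (F := fun z => ut (z 0)) hA hB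
      (fun z hz => by
        have hz' : z 0 = 0 := hz
        show ut (z 0) = u 0
        rw [hz', hut0])
      (fun z hz => by
        show ut (z 0) = v (z 0)
        exact hut_pos _ hz.1)
    convert hU using 1
    ext z
    simp only [Set.mem_setOf_eq, Set.mem_union, Set.mem_Icc, Set.mem_Ioc]
    constructor
    · rintro ⟨h1, h2⟩
      rcases h1.eq_or_lt with h | h
      · exact Or.inl h.symm
      · exact Or.inr ⟨h, h2⟩
    · rintro (h | ⟨h1, h2⟩)
      · rw [h]; exact ⟨le_rfl, zero_le_one⟩
      · exact ⟨h1.le, h2⟩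
  -- end values
  have hut1 : IsAlgebraic ℚ (ut 1) := by
    rw [hut_pos 1 one_pos, hv]
    simp only [one_pow, div_one]
    exact hg1.sub (isAlgebraic_polynomial_eval hT isAlgebraic_one)
  -- the section symbol
  obtain ⟨S, -, hSA, hper, hreal⟩ :=
    stub_sectionSymbol GK T K ut hGK hT hut_an hut_sa hGKroot hGKet (hut0 ▸ hu0) hut1
  refine ⟨S, hSA, ?_, fun r hr hri => hreal r hr fun z hz => ?_⟩
  · rw [hper, intervalIntegral.integral_congr (fun s hs => ?_)]
    rw [uIcc_of_le zero_le_one] at hs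
    exact hgIcc s hs
  · rw [hri z hz]
    rw [hr] at hz
    exact (hgv (z 0) hz.1).symm

/-- **STANDARD PIECES ARE SYMBOLS.** If `[r] − Σ_j [∫_{(0,1)} g_j] ∈ closure (1a ∪ 2)` with standard
pieces `(g_j, G_j)`, then `r` is normalised: there are a combination `C` of period symbols of curve
type with algebraic coefficients and `ℚ`-semialgebraic paths and realisations `R' s` of `C_s · s` on
`(0,1)` with `evalCombination C = value r` and `[r] − Σ_s [R' s] ∈ M₁` (`piece_symbol` +
`ArcSymbols.assemble`). [cite: HuberWustholz2022, Prop. 12.5] -/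
theorem arcSymbols_of_pieces {ι : Type*} [Fintype ι] (r : KZ.IntegralRep 1) (g : ι → ℝ → ℝ)
    (G : ι → MvPolynomial (Fin 2) ℝ) (R : ι → KZ.IntegralRep 1)
    (hpieces : ∀ j, (∀ d, IsAlgebraic ℚ ((G j).coeff d)) ∧
      (∀ s ∈ Set.Icc (0 : ℝ) 1, AnalyticAt ℝ (g j) s) ∧
      (∀ n, IsAlgebraic ℚ (iteratedDeriv n (g j) 0)) ∧ IsAlgebraic ℚ ((g j) 1) ∧
      IsSemialgebraicFunOn ℚ {z : Fin 1 → ℝ | z 0 ∈ Set.Icc (0 : ℝ) 1} (fun z => (g j) (z 0)) ∧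
      (∀ s ∈ Set.Icc (0 : ℝ) 1, MvPolynomial.eval ![s, (g j) s] (G j) = 0) ∧
      (∀ s ∈ Set.Ioc (0 : ℝ) 1, MvPolynomial.eval ![s, (g j) s] (MvPolynomial.pderiv 1 (G j)) ≠ 0))
    (hR : ∀ j, (R j).domain = {z | z 0 ∈ Set.Ioo (0 : ℝ) 1} ∧
      ∀ z ∈ (R j).domain, (R j).integrand z = g j (z 0))
    (hrel : KZ.of r - ∑ j, KZ.of (R j) ∈ AddSubgroup.closure (KZ.domainAddRel ∪ KZ.changeOfVariablesRel)) :
    ∃ (C : PeriodSymbol →₀ ℂ) (R' : PeriodSymbol → KZ.IntegralRep 1), (∀ s, IsAlgebraic ℚ (C s)) ∧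
      (∀ s ∈ C.support, IsSemialgebraicMapOn ℚ {z : Fin 1 → ℝ | z 0 ∈ Set.Icc (0 : ℝ) 1}
        (fun z => Fin.append (fun i => (s.γ.toFun (z 0) i).re) (fun i => (s.γ.toFun (z 0) i).im))) ∧
      (∀ s ∈ C.support, (R' s).domain = {z | z 0 ∈ Set.Ioo (0 : ℝ) 1} ∧ ∀ z ∈ (R' s).domain,
        (R' s).integrand z = (C s * ∑ i, MvPolynomial.eval (s.γ.toFun (z 0)) (s.ω i) *
          deriv (fun u => s.γ.toFun u i) (z 0)).re) ∧
      evalCombination C = ((r.value : ℝ) : ℂ) ∧ KZ.of r - ∑ s ∈ C.support, KZ.of (R' s) ∈ M₁ := by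
  have hS : ∀ j, ∃ S : PeriodSymbol,
      IsSemialgebraicMapOn ℚ {z : Fin 1 → ℝ | z 0 ∈ Set.Icc (0 : ℝ) 1}
        (fun z => Fin.append (fun i => (S.γ.toFun (z 0) i).re) (fun i => (S.γ.toFun (z 0) i).im)) ∧
      S.period = ((∫ s in (0 : ℝ)..1, g j s : ℝ) : ℂ) ∧
      ∀ r : KZ.IntegralRep 1, r.domain = {z | z 0 ∈ Set.Ioo (0 : ℝ) 1} →
        (∀ z ∈ r.domain, r.integrand z = g j (z 0)) →
        (r.domain = {z | z 0 ∈ Set.Ioo (0 : ℝ) 1} ∧ ∀ z ∈ r.domain, r.integrand z =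
          ((1 : ℂ) * ∑ i, MvPolynomial.eval (S.γ.toFun (z 0)) (S.ω i) *
            deriv (fun t => S.γ.toFun t i) (z 0)).re) := fun j => by
    obtain ⟨hG, han, hTay, hg1, hsa, hroot, het⟩ := hpieces j
    exact piece_symbol (g j) (G j) hG han hTay hg1 hsa hroot het
  choose S hSA hper hreal using hS
  -- reindex by `Fin k`
  set e := (Fintype.equivFin ι).symm with he
  have hrel' : KZ.of r - ∑ j : Fin (Fintype.card ι), KZ.of (R (e j)) ∈
      AddSubgroup.closure (KZ.domainAddRel ∪ KZ.changeOfVariablesRel) := by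
    rw [Equiv.sum_comp e (fun i => KZ.of (R i))]
    exact hrel
  exact assemble r (fun j => g (e j)) (fun j => R (e j)) (fun j => S (e j)) (fun j => hSA (e j))
    (fun j => hper (e j)) (fun j => hR (e j))
    (fun j => (hreal (e j) (R (e j)) (hR (e j)).1 (hR (e j)).2).2) hrel'

end ArcSymbols

/-- **Registered anchor `helper_arcSymbols_2`** (values of real polynomials with algebraic
coefficients at algebraic points are algebraic). [folklore] -/
theorem helper_arcSymbols_2 : ∀ (T : Polynomial ℝ), (∀ i, IsAlgebraic ℚ (T.coeff i)) → ∀ (x : ℝ), IsAlgebraic ℚ x → IsAlgebraic ℚ (T.eval x) :=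
  fun _ hT _ hx => ArcSymbols.isAlgebraic_polynomial_eval hT hx

end Summit.KontsevichZagierPeriods.SymplecticScissors.RealOnePeriodRelations

end
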